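import Summits.SmoothPoincare4.SmoothPoincare4.Theorems.CongruenceShadowsShadowApproximationStubLayerStepZeroOneRealisers
import Summits.SmoothPoincare4.SmoothPoincare4.Theorems.CongruenceShadowsShadowApproximationStubLayerStepZero
import Summits.SmoothPoincare4.SmoothPoincare4.Theorems.CongruenceShadowsShadowApproximationStubNilpotentLayerStepLayerOfData
import Literature.Algebra.Lie.SurfaceGroupGrLie
import HarnessLib

/-!
# Stub `stub_layerStepZeroOne` of line `nilpotent-genus-class` for crux `CongruenceShadows.ShadowApproximation`
(item stmt-SmoothPoincare4-14595, thesis `Summit.SmoothPoincare4.SmoothPoincare4.Theses.CongruenceShadows.ShadowApproximation`)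

Proves the registered stub **`stub_layerStepZeroOne`** verbatim — the LAYER STEP at `(m, c) = (0, 1)`:
2-step → 3-step nilpotent at genus `3`.  Setting: `S = S₃`, `Nᵢ = s4Kernels i` (`N₂ = ⟪b₀, a₁, a₂⟫`),
`γₖ₊₁ = (⊤).lowerCentralSeries k`; given (AUTSYMP) and Goeritz realisation (REAL), for a kernel triple `K`
with `K₀ = N₀`, Waldhausen pairs and `K₂ γ₃ = N₂ γ₃` some `y ∈ A ∩ B = Stab N₀ ∩ Stab N₁` has
`y(N₂ γ₄) = K₂ γ₄`.

PROOF (`layerStepZeroOne_core`; the route (b) of the worker evidence `evidence-layer01.md` on the item —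
the datum is read in the FREE group `S ⧸ K₂`, so no normalisation into `𝒥₂` and no gate identity are needed):
1. PAIR NORMALISATION (landed `exists_ia_of_pair`): the pair `(0,2)` gives an IA `α'` with `α'(N₂) = K₂`;
   `ρ = π ∘ α'⁻¹ : S ↠ F₃` is a surjection with kernel `K₂` (`π` the erasing projection of `N₂`).
2. HONEST DATUM AND CONSTRAINT: the cut letters `X_j = b₀, a₁, a₂` go to `ρ(X_j) ∈ γ₃F` (as
   `K₂ γ₃ = N₂ γ₃`); `d_j = θ₂(ρ X_j) ∈ L₃` (Magnus–Witt symbols `θ` of the landed `stub_freeGroupGrLie`),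
   and `θ₃` of `ρ([a₀,b₀][a₁,b₁][a₂,b₂]) = 1` gives `⁅y₀, d₀⁆ + ⁅d₁, y₁⁆ + ⁅d₂, y₂⁆ = 0` in `L₄` — this is
   where the freeness of `S ⧸ K₂` (here: `K₂ = α'(N₂)`) is consumed.
3. REALISATION (helpers `…Lie`, `…Twists`, `…Realisers`): `lie_realise` writes `-d` as an integer
   combination `∑ m_k e(U_k)` of the data of the six separating twists `U_k ∈ A ∩ B ∩ 𝒥₂`; the product
   `y = ∏ U_k ^ m_k ∈ A ∩ B ∩ 𝒥₂` has datum `θ₂(π(y(X_j)X_j⁻¹)) = -d_j` (data add on `𝒥₂`).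
4. TORSOR CALCULUS (landed `helper_layerOfData` at level `c = 1`): with lifts `u_j ∈ γ₃`, `ρ(u_j) = ρ(X_j)⁻¹`
   (so `u_j X_j ∈ K₂`), `θ₂(π u_j) = -d_j` because the IA `α'` acts trivially on `γ₃/γ₄`
   (`helper_johnsonLayerAction`), hence `π(y(X_j)X_j⁻¹u_j⁻¹) ∈ γ₄F`, so `y(X_j)X_j⁻¹u_j⁻¹ ∈ [N₂,S]γ₄`
   (transfer, no hidden depth of `N₂`), and `helper_layerOfData` yields `y(N₂ γ₄) = K₂ γ₄`.
The hypotheses `IsGroupTrisection`, `K 1 = N₁`, the pairs other than `(0,2)` and the finite SHADOWS are not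
used.  No definitions.
-/

set_option linter.dupNamespace false

noncomputable section

open Subgroup Literature.Topology.FourManifolds Literature.Algebra.Lie Multiplicative
open Summit.SmoothPoincare4.SmoothPoincare4.Theorems.NilpotentShadowsStandard.SaturatedTorsorDescent
open scoped commutatorElement

namespace Summit.SmoothPoincare4.SmoothPoincare4.Theorems.ShadowApproximation.NilpotentGenusClass

namespace LayerZeroOne

/-- The reduced class of a surviving letter is the corresponding free letter. [folklore] -/
theorem reduced_mate (j : Fin 3) :
    (Pi.single (j, !(![true, false, false] : Fin 3 → Bool) j) (1 : ℤ) : surfaceGen 3 → ℤ) ((0 : Fin 3), false) • FreeLieAlgebra.of ℤ (0 : Fin 3) +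
      (Pi.single (j, !(![true, false, false] : Fin 3 → Bool) j) (1 : ℤ) : surfaceGen 3 → ℤ) ((1 : Fin 3), true) • FreeLieAlgebra.of ℤ (1 : Fin 3) +
      (Pi.single (j, !(![true, false, false] : Fin 3 → Bool) j) (1 : ℤ) : surfaceGen 3 → ℤ) ((2 : Fin 3), true) • FreeLieAlgebra.of ℤ (2 : Fin 3) =
    FreeLieAlgebra.of ℤ j := by
  fin_cases j <;> simp

/-- The surface relation at genus `3`: `[a₀,b₀][a₁,b₁][a₂,b₂] = 1`. [folklore] -/
theorem relator_three :
    ⁅(PresentedGroup.of ((0 : Fin 3), false) : SurfaceGroup 3), (PresentedGroup.of ((0 : Fin 3), true) : SurfaceGroup 3)⁆ *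
      ⁅(PresentedGroup.of ((1 : Fin 3), false) : SurfaceGroup 3), (PresentedGroup.of ((1 : Fin 3), true) : SurfaceGroup 3)⁆ *
      ⁅(PresentedGroup.of ((2 : Fin 3), false) : SurfaceGroup 3), (PresentedGroup.of ((2 : Fin 3), true) : SurfaceGroup 3)⁆ = 1 := by
  have h := SurfaceGr.prod_commutator_a_b_eq_one 3
  rw [show List.finRange 3 = [0, 1, 2] from by decide] at h
  simpa [SurfaceGroup.a, SurfaceGroup.b, mul_assoc] using h

/-- **The layer step `(0,1)` at genus 3, core form.** Given (AUTSYMP) at genus `3` and (REAL) for the pair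
`(0,1)`, a subgroup `K₂ = α(N₂)` with `α ∈ Stab N₀` and `K₂ γ₃ = N₂ γ₃` is reached modulo `γ₄` by a
Goeritz element: some `y ∈ Stab N₀ ∩ Stab N₁` has `y(N₂ γ₄) = K₂ γ₄`. [folklore] -/
theorem layerStepZeroOne_core
    (hA : ∀ (φ : SurfaceGroup 3 ≃* SurfaceGroup 3),
      ∃ (F : (surfaceGen 3 → ℤ) ≃ₗ[ℤ] (surfaceGen 3 → ℤ)) (ε : ℤ), (ε = 1 ∨ ε = -1) ∧
        (∀ s : SurfaceGroup 3, toAdd (SurfaceGroup.abelianize 3 (φ s)) = F (toAdd (SurfaceGroup.abelianize 3 s))) ∧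
        ∀ u v : surfaceGen 3 → ℤ, symplForm (F u) (F v) = ε * symplForm u v)
    (hR : ∀ (F : (surfaceGen 3 → ℤ) ≃ₗ[ℤ] (surfaceGen 3 → ℤ)) (ε : ℤ), (ε = 1 ∨ ε = -1) →
      (∀ u v : surfaceGen 3 → ℤ, symplForm (F u) (F v) = ε * symplForm u v) →
      (Submodule.span ℤ ((fun y => (Pi.single y (1 : ℤ) : surfaceGen 3 → ℤ)) '' s4CutSystem 0 0)).map F.toLinearMap =
        Submodule.span ℤ ((fun y => (Pi.single y (1 : ℤ) : surfaceGen 3 → ℤ)) '' s4CutSystem 0 0) →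
      (Submodule.span ℤ ((fun y => (Pi.single y (1 : ℤ) : surfaceGen 3 → ℤ)) '' s4CutSystem 0 1)).map F.toLinearMap =
        Submodule.span ℤ ((fun y => (Pi.single y (1 : ℤ) : surfaceGen 3 → ℤ)) '' s4CutSystem 0 1) →
      ∃ x : SurfaceGroup 3 ≃* SurfaceGroup 3, (s4Kernels 0).map x.toMonoidHom = s4Kernels 0 ∧
        (s4Kernels 1).map x.toMonoidHom = s4Kernels 1 ∧
        ∀ s : SurfaceGroup 3, toAdd (SurfaceGroup.abelianize 3 (x s)) = F (toAdd (SurfaceGroup.abelianize 3 s)))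
    (K2 : Subgroup (SurfaceGroup 3)) (α : SurfaceGroup 3 ≃* SurfaceGroup 3)
    (hα0 : (s4Kernels 0).map α.toMonoidHom = s4Kernels 0) (hα2 : (s4Kernels 2).map α.toMonoidHom = K2)
    (hK2 : K2 ⊔ (⊤ : Subgroup (SurfaceGroup 3)).lowerCentralSeries 2 =
      s4Kernels 2 ⊔ (⊤ : Subgroup (SurfaceGroup 3)).lowerCentralSeries 2) :
    ∃ y : SurfaceGroup 3 ≃* SurfaceGroup 3, (s4Kernels 0).map y.toMonoidHom = s4Kernels 0 ∧
      (s4Kernels 1).map y.toMonoidHom = s4Kernels 1 ∧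
      (s4Kernels 2 ⊔ (⊤ : Subgroup (SurfaceGroup 3)).lowerCentralSeries 3).map y.toMonoidHom =
        K2 ⊔ (⊤ : Subgroup (SurfaceGroup 3)).lowerCentralSeries 3 := by
  -- symbols: Magnus–Witt `θ` on `F₃`, the erasing projection `π` of `N₂`
  obtain ⟨θ, hadd, himg, hker, hof, hbr⟩ := stub_freeGroupGrLie 3
  have hN2 : (s4Kernels 2 : Subgroup (SurfaceGroup 3)) = normalClosure (PresentedGroup.of '' s4CutSystem 0 2) :=
    stub_cutNormalForm 0 2
  obtain ⟨ct, π, hct, hπs, hπker, hπof⟩ := helper_glueErasePi 0 2 (stub_cutNormalForm 0 2)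
  obtain ⟨c0, c1, c2⟩ := ct_values hct
  obtain rfl : ct = (![true, false, false] : Fin 3 → Bool) := funext fun i => by fin_cases i <;> simp [c0, c1, c2]
  have hπker' : π.ker = s4Kernels 2 := hπker
  have hπnhd : π.ker ⊓ (⊤ : Subgroup (SurfaceGroup 3)).lowerCentralSeries 1 ≤ ⁅π.ker, (⊤ : Subgroup (SurfaceGroup 3))⁆ :=
    stub_noHiddenDepth 3 3 π.ker (isFreeOfRank_quotient_ker π hπs)
  -- pair normalisation: an IA `α'` with `α'(N₂) = K₂`; the honest projection `ρ = π ∘ α'⁻¹` with kernel `K₂`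
  have hK2' : K2 ⊔ (⊤ : Subgroup (SurfaceGroup 3)).lowerCentralSeries 1 =
      s4Kernels 2 ⊔ (⊤ : Subgroup (SurfaceGroup 3)).lowerCentralSeries 1 := by
    have e : ∀ P : Subgroup (SurfaceGroup 3), P ⊔ (⊤ : Subgroup (SurfaceGroup 3)).lowerCentralSeries 1 =
        (P ⊔ (⊤ : Subgroup (SurfaceGroup 3)).lowerCentralSeries 2) ⊔ (⊤ : Subgroup (SurfaceGroup 3)).lowerCentralSeries 1 :=
      fun P => by rw [sup_assoc, sup_eq_right.2 (lcs_antitone (show 1 ≤ 2 by decide))]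
    rw [e K2, hK2, ← e]
  obtain ⟨α', hα', hα'2⟩ := exists_ia_of_pair hA hR hα0 hα2 hK2'
  set ρ : SurfaceGroup 3 →* FreeGroup (Fin 3) := π.comp α'.symm.toMonoidHom with hρ
  have hρs : Function.Surjective ρ := hπs.comp α'.symm.surjective
  have hρker : ρ.ker = K2 := by rw [hρ, ker_comp_symm hπker' α', hα'2]
  haveI hK2n : K2.Normal := by rw [← hρker]; infer_instance
  have hρπ : ∀ s, π s = ρ (α' s) := fun s => by simp [hρ]
  -- the cut letters `X j`, their mates `M j`, the honest datum `d j = θ₂(ρ X_j)`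
  set X : Fin 3 → SurfaceGroup 3 := fun j => PresentedGroup.of (j, (![true, false, false] : Fin 3 → Bool) j) with hX
  have hXN : ∀ j, X j ∈ s4Kernels 2 := fun j => by
    rw [← hπker', MonoidHom.mem_ker, hX]; exact pi_cut π hπof j
  have hw : ∀ j, ρ (X j) ∈ (⊤ : Subgroup (FreeGroup (Fin 3))).lowerCentralSeries 2 := fun j => by
    have h1 : X j ∈ K2 ⊔ (⊤ : Subgroup (SurfaceGroup 3)).lowerCentralSeries 2 := by rw [hK2]; exact mem_sup_left (hXN j)
    obtain ⟨k, hk, g, hg, hkg⟩ := Subgroup.mem_sup_of_normal_right.1 h1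
    rw [← hkg, map_mul, (MonoidHom.mem_ker.1 (hρker ▸ hk : k ∈ ρ.ker)), one_mul]
    exact FreeGroupGrLie.map_mem_lcs ρ hg
  set d : Fin 3 → FreeLieAlgebra ℤ (Fin 3) := fun j => θ 2 (ρ (X j)) with hd
  have hdL : ∀ j, d j ∈ wordGrade ℤ (FreeLieAlgebra.of ℤ : Fin 3 → FreeLieAlgebra ℤ (Fin 3)) 3 := fun j => by
    have h1 : θ 2 (ρ (X j)) ∈ θ 2 '' ((⊤ : Subgroup (FreeGroup (Fin 3))).lowerCentralSeries 2 : Set _) := ⟨_, hw j, rfl⟩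
    rw [himg 2] at h1
    exact h1
  -- the honest constraint from the relator in the free group `S₃ ⧸ K₂`
  have hθ0M : ∀ j : Fin 3, θ 0 (ρ (PresentedGroup.of (j, !(![true, false, false] : Fin 3 → Bool) j))) =
      FreeLieAlgebra.of ℤ j := fun j => by
    rw [hρ, MonoidHom.comp_apply, MulEquiv.coe_toMonoidHom, theta0_pi θ hadd hof π hπof]
    have h1 : toAdd (SurfaceGroup.abelianize 3 (α'.symm (PresentedGroup.of (j, !(![true, false, false] : Fin 3 → Bool) j)))) =
        toAdd (SurfaceGroup.abelianize 3 (PresentedGroup.of (j, !(![true, false, false] : Fin 3 → Bool) j) : SurfaceGroup 3)) := by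
      have h2 := ia_symm hα' (PresentedGroup.of (j, !(![true, false, false] : Fin 3 → Bool) j))
      rw [← SurfaceGroup.ker_abelianize_eq_lowerCentralSeries, MonoidHom.mem_ker, map_mul, map_inv,
        mul_inv_eq_one] at h2
      rw [h2]
    rw [h1, SurfaceGroup.abelianize_of, toAdd_ofAdd, reduced_mate]
  have hC : ⁅FreeLieAlgebra.of ℤ (0 : Fin 3), d 0⁆ + ⁅d 1, FreeLieAlgebra.of ℤ (1 : Fin 3)⁆ +
      ⁅d 2, FreeLieAlgebra.of ℤ (2 : Fin 3)⁆ = 0 := by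
    have hrel := congrArg ρ relator_three
    rw [map_one, map_mul, map_mul, map_commutatorElement, map_commutatorElement, map_commutatorElement] at hrel
    have hw0 : ρ (PresentedGroup.of ((0 : Fin 3), true)) ∈ (⊤ : Subgroup (FreeGroup (Fin 3))).lowerCentralSeries 2 := hw 0
    have hw1 : ρ (PresentedGroup.of ((1 : Fin 3), false)) ∈ (⊤ : Subgroup (FreeGroup (Fin 3))).lowerCentralSeries 2 := hw 1
    have hw2 : ρ (PresentedGroup.of ((2 : Fin 3), false)) ∈ (⊤ : Subgroup (FreeGroup (Fin 3))).lowerCentralSeries 2 := hw 2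
    have m0 : ⁅ρ (PresentedGroup.of ((0 : Fin 3), false)), ρ (PresentedGroup.of ((0 : Fin 3), true))⁆ ∈
        (⊤ : Subgroup (FreeGroup (Fin 3))).lowerCentralSeries 3 :=
      Literature.GroupTheory.CombinatorialGroupTheory.commutator_mem_lcs_succ' _ hw0
    have m1 : ⁅ρ (PresentedGroup.of ((1 : Fin 3), false)), ρ (PresentedGroup.of ((1 : Fin 3), true))⁆ ∈
        (⊤ : Subgroup (FreeGroup (Fin 3))).lowerCentralSeries 3 :=
      Literature.GroupTheory.CombinatorialGroupTheory.commutator_mem_lcs_succ hw1 _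
    have m2 : ⁅ρ (PresentedGroup.of ((2 : Fin 3), false)), ρ (PresentedGroup.of ((2 : Fin 3), true))⁆ ∈
        (⊤ : Subgroup (FreeGroup (Fin 3))).lowerCentralSeries 3 :=
      Literature.GroupTheory.CombinatorialGroupTheory.commutator_mem_lcs_succ hw2 _
    have e0 := hbr 0 2 _ (mem_top (ρ (PresentedGroup.of ((0 : Fin 3), false)))) _ hw0
    have e1 := hbr 2 0 _ hw1 _ (mem_top (ρ (PresentedGroup.of ((1 : Fin 3), true))))
    have e2 := hbr 2 0 _ hw2 _ (mem_top (ρ (PresentedGroup.of ((2 : Fin 3), true))))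
    rw [show (0 + 2 + 1 : ℕ) = 3 from rfl] at e0
    rw [show (2 + 0 + 1 : ℕ) = 3 from rfl] at e1 e2
    have hsum := congrArg (θ 3) hrel
    have f0 : θ 0 (ρ (PresentedGroup.of ((0 : Fin 3), false))) = FreeLieAlgebra.of ℤ 0 := hθ0M 0
    have f1 : θ 0 (ρ (PresentedGroup.of ((1 : Fin 3), true))) = FreeLieAlgebra.of ℤ 1 := hθ0M 1
    have f2 : θ 0 (ρ (PresentedGroup.of ((2 : Fin 3), true))) = FreeLieAlgebra.of ℤ 2 := hθ0M 2
    rw [theta_one θ hadd, hadd 3 _ (mul_mem m0 m1) _ m2, hadd 3 _ m0 _ m1, e0, e1, e2, f0, f1, f2] at hsum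
    exact hsum
  -- realisation: integers `m`, the six realisers `U`, and the Goeritz element `y = ∏ U_k ^ m_k`
  obtain ⟨m, hm⟩ := lie_realise d hdL hC
  obtain ⟨U, hU⟩ := exists_realisers θ hadd hker hof hbr π hπof
  set y : SurfaceGroup 3 ≃* SurfaceGroup 3 :=
    ((List.finRange 6).map fun k => ((U k : MulAut (SurfaceGroup 3)) ^ m k : MulAut (SurfaceGroup 3))).prod with hy
  have hyU := fun s => datum_list_prod_zpow θ hadd hker π (List.finRange 6) U m (fun k => (hU k).2.2.1) s
  have hy2 : ∀ s, y s * s⁻¹ ∈ (⊤ : Subgroup (SurfaceGroup 3)).lowerCentralSeries 2 := (hyU 1).1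
  have hydat : ∀ j, θ 2 (π (y (X j) * (X j)⁻¹)) = -d j := fun j => by
    rw [hy, (hyU (X j)).2]
    have h1 : ((List.finRange 6).map fun k => m k • θ 2 (π (U k (X j) * (X j)⁻¹))) =
        (List.finRange 6).map fun k => m k • ∑ l, (![![![0, 0, 0, -1, 0, 0, 0, 0], ![-1, 0, 0, 0, 0, 0, 0, 0], ![0, 0, 0, 0, 0, 0, 0, 0]],
    ![![0, 0, 0, 0, 0, 0, -1, 0], ![0, 0, 0, 0, 0, 0, 0, 0], ![0, -1, 0, 0, 0, 0, 0, 0]],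
    ![![0, 0, 0, 0, 0, 0, 0, 0], ![0, 0, 0, 0, 0, 0, 0, 1], ![0, 0, 0, 0, -1, 0, 0, 0]],
    ![![0, 0, -1, -1, 0, -2, -1, 0], ![-1, -1, 0, 0, 0, 0, 0, 0], ![-1, -1, 0, 0, 0, 0, 0, 0]],
    ![![0, 0, 0, -1, -1, 0, 0, 0], ![-1, 0, -1, 0, 0, 1, 0, 1], ![0, 0, 0, -1, -1, 0, 0, 0]],
    ![![0, 0, 0, 0, 0, 0, -1, -1], ![0, 0, 0, 0, 0, 0, 1, 1], ![0, -1, -2, 0, -1, -1, 0, 0]]] : Fin 6 → Fin 3 → Fin 8 → ℤ) k j l • (![⁅FreeLieAlgebra.of ℤ (0 : Fin 3), ⁅FreeLieAlgebra.of ℤ (0 : Fin 3), FreeLieAlgebra.of ℤ (1 : Fin 3)⁆⁆,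
    ⁅FreeLieAlgebra.of ℤ (0 : Fin 3), ⁅FreeLieAlgebra.of ℤ (0 : Fin 3), FreeLieAlgebra.of ℤ (2 : Fin 3)⁆⁆,
    ⁅FreeLieAlgebra.of ℤ (0 : Fin 3), ⁅FreeLieAlgebra.of ℤ (1 : Fin 3), FreeLieAlgebra.of ℤ (2 : Fin 3)⁆⁆,
    ⁅FreeLieAlgebra.of ℤ (1 : Fin 3), ⁅FreeLieAlgebra.of ℤ (0 : Fin 3), FreeLieAlgebra.of ℤ (1 : Fin 3)⁆⁆,
    ⁅FreeLieAlgebra.of ℤ (1 : Fin 3), ⁅FreeLieAlgebra.of ℤ (1 : Fin 3), FreeLieAlgebra.of ℤ (2 : Fin 3)⁆⁆,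
    ⁅FreeLieAlgebra.of ℤ (2 : Fin 3), ⁅FreeLieAlgebra.of ℤ (0 : Fin 3), FreeLieAlgebra.of ℤ (1 : Fin 3)⁆⁆,
    ⁅FreeLieAlgebra.of ℤ (2 : Fin 3), ⁅FreeLieAlgebra.of ℤ (0 : Fin 3), FreeLieAlgebra.of ℤ (2 : Fin 3)⁆⁆,
    ⁅FreeLieAlgebra.of ℤ (2 : Fin 3), ⁅FreeLieAlgebra.of ℤ (1 : Fin 3), FreeLieAlgebra.of ℤ (2 : Fin 3)⁆⁆] :
      Fin 8 → FreeLieAlgebra ℤ (Fin 3)) l := List.map_congr_left fun k _ => by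
      rw [hX, (hU k).2.2.2 j]
    rw [h1, ← Fin.sum_univ_def, eq_neg_iff_add_eq_zero, hm j]
  have hy0 : (s4Kernels 0).map y.toMonoidHom = s4Kernels 0 :=
    map_list_prod_eq _ _ _ fun k => map_zpow_eq_of_map_eq _ (hU k).1 _
  have hy1 : (s4Kernels 1).map y.toMonoidHom = s4Kernels 1 :=
    map_list_prod_eq _ _ _ fun k => map_zpow_eq_of_map_eq _ (hU k).2.1 _
  -- lifts `u` of the honest datum: `u ∈ γ₃`, `ρ u = (ρ X_j)⁻¹`
  have hex : ∀ s : SurfaceGroup 3, ∃ v : SurfaceGroup 3, (ρ s ∈ (⊤ : Subgroup (FreeGroup (Fin 3))).lowerCentralSeries 2 →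
      v ∈ (⊤ : Subgroup (SurfaceGroup 3)).lowerCentralSeries 2 ∧ ρ v = (ρ s)⁻¹) := fun s => by
    by_cases hs : ρ s ∈ (⊤ : Subgroup (FreeGroup (Fin 3))).lowerCentralSeries 2
    · have h1 : (ρ s)⁻¹ ∈ ((⊤ : Subgroup (SurfaceGroup 3)).lowerCentralSeries 2).map ρ := by
        rw [map_lcs_eq_of_surjective ρ hρs 2]; exact inv_mem hs
      obtain ⟨v, hv, hve⟩ := h1
      exact ⟨v, fun _ => ⟨hv, hve⟩⟩
    · exact ⟨1, fun h => absurd h hs⟩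
  choose u hu using hex
  -- the layer step from realised data
  have key := helper_layerOfData 3 1 (PresentedGroup.of '' s4CutSystem 0 2) K2
    (stub_noHiddenDepth 3 3 K2 ((isFreeOfRank_quotient_ker ρ hρs).of_mulEquiv (QuotientGroup.quotientMulEquivOfEq hρker)))
    (by rw [← hN2]; exact hK2) y hy2 u ?_ ?_ ?_
  · rw [← hN2] at key
    exact ⟨y, hy0, hy1, key⟩
  · rintro _ ⟨⟨j, c⟩, hjc, rfl⟩
    obtain rfl : c = (![true, false, false] : Fin 3 → Bool) j := (hct j c).1 hjc
    exact ((hu (X j)) (hw j)).1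
  · rintro _ ⟨⟨j, c⟩, hjc, rfl⟩
    obtain rfl : c = (![true, false, false] : Fin 3 → Bool) j := (hct j c).1 hjc
    rw [← hρker, MonoidHom.mem_ker, map_mul, ((hu (X j)) (hw j)).2, inv_mul_cancel]
  · rintro _ ⟨⟨j, c⟩, hjc, rfl⟩
    obtain rfl : c = (![true, false, false] : Fin 3 → Bool) j := (hct j c).1 hjc
    obtain ⟨hu2, hue⟩ := (hu (X j)) (hw j)
    rw [← hN2, ← hπker']
    have hs2 : y (X j) * (X j)⁻¹ * (u (X j))⁻¹ ∈ (⊤ : Subgroup (SurfaceGroup 3)).lowerCentralSeries 2 :=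
      mul_mem (hy2 _) (inv_mem hu2)
    refine mem_commutator_sup_of_map_mem₃ π hπs hπnhd hs2 ?_
    rw [← (hker 2 _ (FreeGroupGrLie.map_mem_lcs π hs2)), map_mul,
      hadd 2 _ (FreeGroupGrLie.map_mem_lcs π (hy2 _)) _ (FreeGroupGrLie.map_mem_lcs π (inv_mem hu2)), hydat j, map_inv,
      theta_inv θ hadd 2 (FreeGroupGrLie.map_mem_lcs π hu2)]
    -- `θ₂(π u) = θ₂(ρ u) = -d j` since `α'` acts trivially on `γ₃/γ₄`
    have hπu : θ 2 (π (u (X j))) = -d j := by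
      have h3 : α' (u (X j)) * (u (X j))⁻¹ ∈ (⊤ : Subgroup (SurfaceGroup 3)).lowerCentralSeries (1 + 2) :=
        jk_lcs α'.toMonoidHom hα' 2 _ hu2
      rw [hρπ, show α' (u (X j)) = (α' (u (X j)) * (u (X j))⁻¹) * u (X j) by rw [inv_mul_cancel_right], map_mul,
        theta_mul_of_mem_succ θ hadd hker 2 (FreeGroupGrLie.map_mem_lcs ρ h3) (FreeGroupGrLie.map_mem_lcs ρ hu2), hue,
        theta_inv θ hadd 2 (hw j)]
    rw [hπu, neg_neg, neg_add_cancel]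

end LayerZeroOne

open LayerZeroOne in
/-- **The layer step at `(m, c) = (0, 1)`** (registered stub `stub_layerStepZeroOne` of the line
`nilpotent-genus-class`): 2-step → 3-step nilpotent at genus `3`.  Proof: `layerStepZeroOne_core` with
`α` from the Waldhausen pair `(0, 2)`; the hypotheses `IsGroupTrisection`, `K 1 = N₁` and the finite
shadows are not needed (the freeness of `S ⧸ K₂` is read off `K₂ = α(N₂)`). [folklore] -/
theorem stub_layerStepZeroOne :
    (∀ (g : ℕ) (φ : SurfaceGroup g ≃* SurfaceGroup g),
      ∃ (F : (surfaceGen g → ℤ) ≃ₗ[ℤ] (surfaceGen g → ℤ)) (ε : ℤ), (ε = 1 ∨ ε = -1) ∧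
        (∀ s : SurfaceGroup g,
          toAdd (SurfaceGroup.abelianize g (φ s)) = F (toAdd (SurfaceGroup.abelianize g s))) ∧
        ∀ u v : surfaceGen g → ℤ, symplForm (F u) (F v) = ε * symplForm u v) →
    (∀ (m : ℕ) (F : (surfaceGen (3 + 3 * m) → ℤ) ≃ₗ[ℤ] (surfaceGen (3 + 3 * m) → ℤ)) (ε : ℤ),
      (ε = 1 ∨ ε = -1) →
      (∀ u v : surfaceGen (3 + 3 * m) → ℤ, symplForm (F u) (F v) = ε * symplForm u v) →
      (Submodule.span ℤ ((fun y => (Pi.single y (1 : ℤ) : surfaceGen (3 + 3 * m) → ℤ)) ''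
          s4CutSystem m 0)).map F.toLinearMap =
        Submodule.span ℤ ((fun y => (Pi.single y (1 : ℤ) : surfaceGen (3 + 3 * m) → ℤ)) ''
          s4CutSystem m 0) →
      (Submodule.span ℤ ((fun y => (Pi.single y (1 : ℤ) : surfaceGen (3 + 3 * m) → ℤ)) ''
          s4CutSystem m 1)).map F.toLinearMap =
        Submodule.span ℤ ((fun y => (Pi.single y (1 : ℤ) : surfaceGen (3 + 3 * m) → ℤ)) ''
          s4CutSystem m 1) →
      ∃ x : SurfaceGroup (3 + 3 * m) ≃* SurfaceGroup (3 + 3 * m),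
        (s4Kernels.stabilizeIter m 0).map x.toMonoidHom = s4Kernels.stabilizeIter m 0 ∧
        (s4Kernels.stabilizeIter m 1).map x.toMonoidHom = s4Kernels.stabilizeIter m 1 ∧
        ∀ s : SurfaceGroup (3 + 3 * m),
          toAdd (SurfaceGroup.abelianize (3 + 3 * m) (x s)) =
            F (toAdd (SurfaceGroup.abelianize (3 + 3 * m) s))) →
    ∀ (K : TrisectionKernels (3 + 3 * 0)),
      IsGroupTrisection (3 + 3 * 0) (0 + 1) (PUnit : Type) K →
      K 0 = s4Kernels.stabilizeIter 0 0 → K 1 = s4Kernels.stabilizeIter 0 1 →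
      (∀ i j : Fin 3, i ≠ j → ∃ α : SurfaceGroup (3 + 3 * 0) ≃* SurfaceGroup (3 + 3 * 0),
        (s4Kernels.stabilizeIter 0 i).map α.toMonoidHom = K i ∧
          (s4Kernels.stabilizeIter 0 j).map α.toMonoidHom = K j) →
      (∀ M : Subgroup (SurfaceGroup (3 + 3 * 0)), M.Characteristic → M.FiniteIndex →
        ∃ ψ : SurfaceGroup (3 + 3 * 0) ≃* SurfaceGroup (3 + 3 * 0), ∀ i : Fin 3,
          (s4Kernels.stabilizeIter 0 i ⊔ M).map ψ.toMonoidHom = K i ⊔ M) →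
      K 2 ⊔ (⊤ : Subgroup (SurfaceGroup (3 + 3 * 0))).lowerCentralSeries (1 + 1) =
        s4Kernels.stabilizeIter 0 2 ⊔ (⊤ : Subgroup (SurfaceGroup (3 + 3 * 0))).lowerCentralSeries (1 + 1) →
      ∃ y : SurfaceGroup (3 + 3 * 0) ≃* SurfaceGroup (3 + 3 * 0),
        (s4Kernels.stabilizeIter 0 0).map y.toMonoidHom = s4Kernels.stabilizeIter 0 0 ∧
        (s4Kernels.stabilizeIter 0 1).map y.toMonoidHom = s4Kernels.stabilizeIter 0 1 ∧
        (s4Kernels.stabilizeIter 0 2 ⊔ (⊤ : Subgroup (SurfaceGroup (3 + 3 * 0))).lowerCentralSeries (1 + 1 + 1)).map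
            y.toMonoidHom =
          K 2 ⊔ (⊤ : Subgroup (SurfaceGroup (3 + 3 * 0))).lowerCentralSeries (1 + 1 + 1) := by
  intro hA hR K _hK hK0 _hK1 hW _hS hK2
  obtain ⟨α, hα0, hα2⟩ := hW 0 2 (by decide)
  have hα0' : (s4Kernels 0).map α.toMonoidHom = s4Kernels 0 := by
    have h : (s4Kernels.stabilizeIter 0 0).map α.toMonoidHom = K 0 := hα0
    rw [hK0] at h
    exact h
  have hα2' : (s4Kernels 2).map α.toMonoidHom = K 2 := hα2
  have hK2' : K 2 ⊔ (⊤ : Subgroup (SurfaceGroup 3)).lowerCentralSeries 2 =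
      s4Kernels 2 ⊔ (⊤ : Subgroup (SurfaceGroup 3)).lowerCentralSeries 2 := hK2
  obtain ⟨y, h0, h1, h2⟩ := layerStepZeroOne_core (hA 3) (hR 0) (K 2) α hα0' hα2' hK2'
  exact ⟨y, h0, h1, h2⟩

end Summit.SmoothPoincare4.SmoothPoincare4.Theorems.ShadowApproximation.NilpotentGenusClass

end
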